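import Literature.MathematicalPhysics.QuantumFieldTheory.Balaban1983to89.B2Lemma24RemD
import Literature.MathematicalPhysics.QuantumFieldTheory.Balaban1983to89.B4Lemma22BoxNoCollar

/-!
# [B2] Lemma 2.4, proof p. 572 «Using the expansion formula (I.3.44) and Proposition I.2.2»: the two SUP-NORM INPUTS
# `sup_g`, `sup_Dg` (`‖a_kG_k(□,A^{(k)})Q_k^*(A^{(k)})□₁φ‖_∞`, `‖D^η_{A^{(k)},μ}(…)‖_∞ ≤ c_I‖□₁φ‖_∞`) of the model family of
# record `B2Lemma24Proof.Model` / `B2Lemma24RemD.ModelR` DISCHARGED for the box carrier's own objects — the corner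
# embedding, staircase contours `Γ^{(k)}_{y,x}` and a (2.23)/(1.7)-REGULAR component field `A^{(k)}` with NO collar — by
# [B4] Lemma 2.2 (2.17) at `(p,q) = (∞,∞)` WITHOUT «Ã constant in a neighbourhood of ∂□» (`B4Lemma22BoxNoCollar`)

statement-level skeleton of published theorems with citation tags; proofs where landed; nothing here is a claim about
the Yang–Mills mass gap

**Sources.** T. Bałaban, *(Higgs)₂,₃ quantum fields in a finite volume. II. An upper bound*, Commun. Math. Phys. **86**
(1982) 555–594 (bib key `Balaban1982Higgs2`, «B2»; journal page = PDF page + 554): (2.55)–(2.56) p. 570, Lemma 2.3 (2.60)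
p. 571, Lemma 2.4 (2.65)–(2.66) p. 572 and its proof (2.67)–(2.77) pp. 572–574, in particular (2.68) p. 572 (render
`run/shared/lean/pub/pub-balaban/b2b-balaban-ref1/pages/1982-cmp86-higgs23-II/1982-cmp86-higgs23-II-p018-x2.png` re-read
as an image); T. Bałaban, *Regularity and decay of lattice Green's functions*, Commun. Math. Phys. **89** (1983) 571–597
(bib key `Balaban1983RegularityDecay`, «B4»): Lemma 2.2 (2.17) pp. 577–578, (1.7) p. 572, p. 579 «if Ω is a rectangular
parallelepiped, then all □_j … are cubes and we can apply Lemma 2.2 to all operators in it».  A NEW LEAF over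
`B2Lemma24RemD` (lit-balaban r04 g18, p336252: `FrameR`, `ModelR`, `lemma24Printed_modelR`; over p23 g5's
`B2Lemma24Proof`: `Frame`, `Model`, `lemma24_bounds`) and `B4Lemma22BoxNoCollar` (r04 g15, p326682/p329670:
`lemma22_sup_noCollar`); no existing module is touched, no definition of record altered, nothing of [B2]/[B4] asserted as
a fact.  Unit `lit-balaban-p23` gen 18 (Phase-2 proof seat p23, owner of `B2Lemma24Proof`), 2026-08-22; SKELETON row
**B2.Lem2.4** (fold owner r02, second reader r14; decl of record `B2.Lemma24Printed`; head by the fold owner's criterion —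
this file files no head claim), cells only; follows r04 g18's pointer (seat INBOX 17:51:31Z «possible later upgrade:
`sup_g`/`sup_Dg` at the regular non-collared `A^{(k)}` from `B4Lemma22BoxNoCollar.lemma22_sup_noCollar` for the
staircase-contour sub-family»).  [v1.1 (same seat, same gen): §6 appended, §§1–5 byte-identical; three `open` lists extended.  v1.2 (same): §7
appended, §§1–6 byte-identical.  v1.3 (p23 gen 20), DOCSTRING-ONLY — every declaration byte-identical —: the locator of
[B4] (1.6)/(1.7) corrected «p. 573» → «p. 572» throughout ((1.1)–(1.7) are the displays of CMP 89 p. 572 [PDF 2]; r04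
CITELOC-AUDIT-g22 §3, summit-lit1 CITELOC #21 P84-003).]

## WHAT IS PRINTED (verbatim «…»)

[B2] p. 572 [PDF 18]: «Using the expansion formula (I.3.44) and Proposition I.2.2. we have (a_kG_k(□, A^{(k)})Q_k^*(A^{(k)})
□₁φ)(x) = (a_kG_k(□, A₀)Q_k^*(A₀)□₁φ)(x) + (a_kG_k(□, A₀)F_{2,k}(A^{(k)} − A₀, A₀)□₁φ)(x) + (a_kG_k(□, A₀)V_k(A^{(k)} − A₀,
A₀)G_k(□, A^{(k)})Q_k^*(A^{(k)})□₁φ)(x) = (a_kG_k(□, A₀)Q_k^*(A₀)□₁φ)(x) + O((L^kε)^{κ₀}), κ₀ > 0, (2.68) and similarly for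
the derivative.»  [B2] p. 571, after (2.60): «The inequality (2.60) implies that the configuration A^{(k)} considered on the
set B^k(Λ₂^{(k−1)′}) satisfies the assumption of Proposition I.2.1. on a vector field configuration.»  [B4] p. 572 (1.7):
«|(∂^η_μA)(x)| ≤ ce^{β−1}»; pp. 577–578, Lemma 2.2: «… ‖G_k(□,Ã)f‖_q, ‖D^η_{Ã,μ}G_k(□,Ã)f‖_q, ‖G_k(□,Ã)D^{η*}_{Ã,μ}f‖_q ≤
c₂‖f‖_p (2.17) for 1 ≤ p, q ≤ ∞, satisfying the condition 1/p − 1/p₁ ≤ 1/q ≤ 1/p with p₁ > d.»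

## WHAT REPLACES THE TWO INPUTS (dictionary)

`B2Lemma24Proof.Model` (hence `B2Lemma24RemD.ModelR`) carries, for the third term of (2.68), the sup bounds of
`g = a_kG_k(□, A^{(k)})Q_k^*(A^{(k)})□₁φ` and of `D^η_{A^{(k)},μ}g` over the WHOLE fine box `□` as hypothesis fields `sup_g`,
`sup_Dg` (print: «Proposition I.2.2»; in [B4]'s numbering the sup members of Lemma 2.2 (2.17) at `(p, q) = (∞, ∞)` for the
cube `□` — no `R₀`-restriction, p. 579's parallelepiped sentence / I p. 611 «For some simple sets Ω, e.g. for rectangular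
parallelepipeds, the inequalities hold without any restrictions on the points»).  Here the instance fixes the model's free
contour data to the box lineage's OWN objects — corner embedding `baseEmb`, staircase contours `stairContour` (ending at the
averaged point: `stairContour_end`), charge `κ = e/L^k` — and its field `A^{(k)}|_□ = A₀ + A'` to a COMPONENT FIELD `Ac`
(`A' := compField Ac − constBond A₀`, so `A₀ + A' = compField Ac` exactly), (2.23)/(1.7)-regular on `□`:
`|Ac(x + e_μ)_ν − Ac(x)_ν| ≤ c_reg·e^{β−1}/L^k` (NO collar, NO constancy near `∂□`), `0 < e ≤ e₁(c_reg, β, S)`, box sides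
`M_μ ≤ S` unit blocks, fine sides `≥ 3`.  For such data r04's `B4Lemma22BoxNoCollar.lemma22_sup_noCollar` gives
`‖G_k(□,A)Φ‖_∞, ‖D^η_{A,μ}G_k(□,A)Φ‖_∞ ≤ C‖Φ‖_∞`, whence `sup_g`, `sup_Dg` with `c_I ≥ a₊·C` (`‖Q_k^*(A)□₁φ‖_∞ ≤ ‖□₁φ‖_∞` by
orthogonality of the transporters, `B4Lemma22PertVSup.avgT_site`; `a_k ≤ a₊`).

## WHAT THIS FILE CERTIFIES (kernel-checked, zero `sorry`; standard axioms)

* §1 `cNC`, `cNC_spec`, `eNC`, `eNC_spec`: the constant `C` and the threshold `e₁(c_reg, β, S)` of `lemma22_sup_noCollar`,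
  chosen once per (flow, Lipschitz data, `d`, `ℓ`, window) resp. per `(c_reg, β, S)`.
* §2 `FrameS` = `B2Lemma24RemD.FrameR` + (`c_reg ≥ 0`, `β > 0`, `S`, and `hcI : a₊·C ≤ c_I`); `FrameS.ofFrameR`: EVERY `FrameR`
  upgrades (its `c_I` and `K_D` enlarged to maxima — a choice of constants, not a hypothesis on the data).
* §3 the box lineage's own contour/field data: `κS` (`e/L^k`), `embS` (`baseEmb`), `ΓS` (`stairContour`), `AprS`
  (`compField Ac − constBond A₀`), `constBond_add_AprS` (`A₀ + A' = compField Ac`).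
* §4 `ModelS fr Yo` = the fields of `ModelR` MINUS {`κ`, `emb`, `Γ`, `hend`, `A'`, `sup_g`, `sup_Dg`} PLUS {`e`, `he`, `hle`
  (`0 < e ≤ e₁`), `hMS` (`M_μ ≤ S`), `hM3` (`3 ≤ L^kM_μ`), `Ac`, `hreg` ((2.23)/(1.7) on `□`)}, every remaining hypothesis
  field stated for the substituted data; **`ModelS.sup_g`**, **`ModelS.sup_Dg`** — THE TWO INPUTS ARE THEOREMS;
  `ModelS.toModelR` (the `ModelR` instance, `sup_g`/`sup_Dg := the theorems`, `hend := stairContour_end`).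
* §5 `famOfS := famOfR ∘ toModelR`, **`lemma24Printed_modelS : B2.Lemma24Printed (famOfS fr Yo)`** by r04's
  `lemma24Printed_modelR`.
* §6 (v1.1) FOUR MORE FIELDS OF `ModelS` ARE FREE OR DERIVED (theorems over the raw data, for any constructor to use):
  `hunit_holds` (`H_k(□, A)` with the staircase data is invertible for EVERY `A` — `B4Lemma22Invertible.opA_stair_isUnit_det`);
  `AprS_step`/`AprS_step_rev` (`A′(x, x ± e_μ) = ±(Ac_μ − A₀_μ)`); **`hder_of_hreg`** (`hder` with `θ′ = c_reg e^β`);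
  `osc_of_hreg` (`|Ac(u)_ν − Ac(x₀)_ν| ≤ 2(d+1)S·c_reg e^{β−1}` on `□`, two monotone staircases from the corner);
  **`hA'_of_hreg`** (`hA'` with `θ = 2(d+1)S·c_reg·e^β` once `A₀ = A^{(k)}(x₀)`, `x₀ ∈ □` — print's `A₀ = A^{(k)}(y)`);
  **`hτA_of_hA'`** (`hτA` with `τ = (d+1)θ`, `B4Lemma22SupStair.stair_lsum_le`).
* §7 (v1.2) **`ModelT`** = `ModelS` MINUS {`A₀` (:= `A^{(k)}(x₀)`, base point `x₀ ∈ □`), `hunit`, `θ, hθ, hθ1, hA'`, `τ, hτ,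
  hτ1, hτA`, `θ', hθ', hder`} PLUS the smallness hypotheses `θ ≤ 1`, `(d+1)θ ≤ 1` on `e` (`θ = 2(d+1)S c_reg e^β`) and the
  three scale products for the derived `θ, τ, θ′`; `ModelT.toModelS` (the §6 theorems fill the removed fields);
  `famOfT := famOfS ∘ toModelS`; **`lemma24Printed_modelT : B2.Lemma24Printed (famOfT fr Yo)`** — the Lemma 2.4 family whose ONLY
  hypothesis SHAPES are the four (2.58) kernel fields.

## HONEST SCOPE

(a) Sub-family, not a generalisation: contour system and charge are FIXED to the lineage's staircase data (print's
`Γ^{(k)}_{y,x}` IS a fixed contour system; the model had it free), and `A^{(k)}|_□` is a component field, (2.23)-regular on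
`□` — the printed hypothesis («A^{(k)} … satisfies the assumption of Proposition I.2.1», p. 571) in [B4] (1.7) form with
free `c_reg, β` and the running charge `e ≤ e₁` («for e(L^kε) sufficiently small»).  (b) What REMAINS a hypothesis shape in
`ModelS` (unchanged from `ModelR`): Proposition 2.2 (2.58) for `Ω = B^k(Λ₂′)` and its `δG`-clause against `□`
(`kerΩ_far/near`, `dkerΩ_far/near`), invertibility `hunit`, the field sizes `hA'`/`hτA`/`hder` ((2.60) consequences, now
about `compField Ac − constBond A₀`) and the scale products — hence the row's kind is still «model instance» under G.1;
this file removes the [B4] (2.17)_∞ / «Proposition I.2.2» pair only.  [v1.1, §6: of these, `hunit` is FREE and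
`hder`/`hA'`/`hτA` are DERIVED from `hreg` (with `A₀ = Ac(x₀)`, `θ′ = c_reg e^β`, `θ = 2(d+1)S c_reg e^β`, `τ = (d+1)θ`) as
theorems over the raw data — the fields stay in the structure for compatibility with `ModelR`; the demands `θ, τ ≤ 1` and
the scale products `θt_φ ≤ K_θ`, … then read as smallness of `e(L^kε)` against `S` and the threshold, i.e. the printed
«O(p(Lᵏε)r(Lᵏε))·(threshold) = O((Lᵏε)^{κ₀})» bookkeeping, which remains the instance's hypothesis.  Genuinely
remaining SHAPES: the four (2.58) kernel fields only — v1.2 §7 records exactly this as the structure `ModelT`.]  (c) Constants: `C` on `(d, N, ℓ₁, L, a₋, a₊, m²₊)`,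
`e₁` on these and `(c_reg, β, S)` (r04's HONEST SCOPE (iii)); `S` bounds the box `□₂` in unit blocks (print: `□₂` has
`≤ 8r(L^kε) + O(1)` blocks a side — `S` is per instance family, so the family is «all steps with `□₂` of at most `S` blocks a
side»; a successor wanting `S` to grow with `k` must thread r04's `e₁(S)` dependence explicitly).  (d) `d + 1 ≥ 2` lattice
dimensions (`FrameR.hd`).  (e) `Model`, `ModelR` untouched: `toModelR`/`toModel` feed them verbatim, so every theorem of
`B2Lemma24Proof`/`B2Lemma24RemD` applies.  Value = two hypothesis fields of the Lemma 2.4 family replaced by a PROVED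
[B4] theorem of the tree; NOT summit progress.
-/

namespace Literature.MathematicalPhysics.QuantumFieldTheory.Balaban1983to89.B2Lemma24SupG

open Finset Matrix
open Literature.MathematicalPhysics.QuantumFieldTheory.Balaban1983to89.B4GaugeCovariance
open Literature.MathematicalPhysics.QuantumFieldTheory.Balaban1983to89.B4Lower18Regular (e1 lsum baseEmb stairContour
  stairContour_end stair pathEnd_stair length_stair_le mem_stair mem_boxDom_of_between)
open Literature.MathematicalPhysics.QuantumFieldTheory.Balaban1983to89.B4Lower18RegularRegion (compField pathRel_stairL_up
  pathRel_and pathRel_chain abs_sub_le_of_pathRel)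
open Literature.MathematicalPhysics.QuantumFieldTheory.Balaban1983to89.B4Lemma21Region (siteNorm)
open Literature.MathematicalPhysics.QuantumFieldTheory.Balaban1983to89.B4Reflection242 (nbrs mem_nbrs boxDom mem_boxDom blk)
open Literature.MathematicalPhysics.QuantumFieldTheory.Balaban1983to89.B4ContourShift (supNorm)
open Literature.MathematicalPhysics.QuantumFieldTheory.Balaban1983to89.B4Lemma22Reduce231
open Literature.MathematicalPhysics.QuantumFieldTheory.Balaban1983to89.B4Lemma22ReduceZero (Box greenA greenA0
  opA derivA derivA0)
open Literature.MathematicalPhysics.QuantumFieldTheory.Balaban1983to89.B4Lemma22PertVSup (supN_smul_le avgT_site)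
open Literature.MathematicalPhysics.QuantumFieldTheory.Balaban1983to89.B2Eq268GaugeAway
open Literature.MathematicalPhysics.QuantumFieldTheory.Balaban1983to89.B2Lemma24Proof
open Literature.MathematicalPhysics.QuantumFieldTheory.Balaban1983to89.B2Lemma24RemD

noncomputable section

variable {ι : Type} [Fintype ι] [DecidableEq ι]

/-! ## §1 The constant and the threshold of [B4] Lemma 2.2 (2.17)_∞ without collar, chosen once -/

section Const

variable (F : OrthFlow ι) {ℓ₁ : ℝ} (hℓ₁ : 0 ≤ ℓ₁)
  (hLip : ∀ t (v : ι → ℝ), ((F.U t - 1) *ᵥ v) ⬝ᵥ ((F.U t - 1) *ᵥ v) ≤ (ℓ₁ * t) ^ 2 * (v ⬝ᵥ v))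
  (d ℓ : ℕ) (hℓ : 1 ≤ ℓ) (amin aplus m2plus : ℝ) (ha : 0 < amin)

/-- the constant `C` of `B4Lemma22BoxNoCollar.lemma22_sup_noCollar` (depends on `d, N, ℓ₁, L`, the window only).
[cite: Balaban1983RegularityDecay, Lemma 2.2 (2.17) pp. 577–578] -/
def cNC : ℝ :=
  (B4Lemma22BoxNoCollar.lemma22_sup_noCollar F hℓ₁ hLip d ℓ hℓ amin aplus m2plus ha).choose

/-- the defining property of `cNC`. [cite: Balaban1983RegularityDecay, Lemma 2.2 (2.17) pp. 577–578, p. 579] -/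
theorem cNC_spec :
    0 < cNC F hℓ₁ hLip d ℓ hℓ amin aplus m2plus ha ∧ ∀ (creg β : ℝ), 0 ≤ creg → 0 < β → ∀ (S : ℕ),
      ∃ e₁ : ℝ, 0 < e₁ ∧ ∀ (k : ℕ), 1 ≤ k → ∀ (hn : 1 ≤ (ℓ + 1) ^ k) (a m2 : ℝ),
      amin ≤ a → a ≤ aplus → 0 ≤ m2 → m2 ≤ m2plus →
      ∀ (M : Fin (d + 1) → ℕ), (∀ i, 1 ≤ M i) → (∀ i, M i ≤ S) → (∀ i, 3 ≤ (ℓ + 1) ^ k * M i) →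
      ∀ (Ac : (Fin (d + 1) → ℤ) → Fin (d + 1) → ℝ) (e : ℝ), 0 < e → e ≤ e₁ →
        (∀ x ∈ Box d ℓ k M, ∀ μ ν : Fin (d + 1),
          |Ac (x + e1 μ) ν - Ac x ν| ≤ creg * e ^ (β - 1) / ((ℓ + 1) ^ k : ℕ)) →
      ∀ Φ : ↥(Box d ℓ k M) × ι → ℝ,
        supN (greenA d F (e / ((ℓ + 1) ^ k : ℕ)) ℓ k a m2 M (baseEmb hn M) (stairContour hn M)
            (fun u v => compField Ac u.1 v.1) *ᵥ Φ) ≤ cNC F hℓ₁ hLip d ℓ hℓ amin aplus m2plus ha * supN Φ ∧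
        ∀ μ : Fin (d + 1),
          supN (derivA d F (e / ((ℓ + 1) ^ k : ℕ)) ℓ k M (fun u v => compField Ac u.1 v.1) μ
              *ᵥ (greenA d F (e / ((ℓ + 1) ^ k : ℕ)) ℓ k a m2 M (baseEmb hn M) (stairContour hn M)
                  (fun u v => compField Ac u.1 v.1) *ᵥ Φ)) ≤ cNC F hℓ₁ hLip d ℓ hℓ amin aplus m2plus ha * supN Φ :=
  (B4Lemma22BoxNoCollar.lemma22_sup_noCollar F hℓ₁ hLip d ℓ hℓ amin aplus m2plus ha).choose_spec

variable (creg β : ℝ) (hcreg : 0 ≤ creg) (hβ : 0 < β) (S : ℕ)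

/-- the threshold `e₁(c_reg, β, S)` of `lemma22_sup_noCollar` («for e sufficiently small»).
[cite: Balaban1983RegularityDecay, Theorem p. 573 «for e sufficiently small», Lemma 2.2 p. 577] -/
def eNC : ℝ :=
  ((cNC_spec F hℓ₁ hLip d ℓ hℓ amin aplus m2plus ha).2 creg β hcreg hβ S).choose

/-- the defining property of `eNC`. [cite: Balaban1983RegularityDecay, Lemma 2.2 (2.17) pp. 577–578, p. 579] -/
theorem eNC_spec :
    0 < eNC F hℓ₁ hLip d ℓ hℓ amin aplus m2plus ha creg β hcreg hβ S ∧
      ∀ (k : ℕ), 1 ≤ k → ∀ (hn : 1 ≤ (ℓ + 1) ^ k) (a m2 : ℝ),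
      amin ≤ a → a ≤ aplus → 0 ≤ m2 → m2 ≤ m2plus →
      ∀ (M : Fin (d + 1) → ℕ), (∀ i, 1 ≤ M i) → (∀ i, M i ≤ S) → (∀ i, 3 ≤ (ℓ + 1) ^ k * M i) →
      ∀ (Ac : (Fin (d + 1) → ℤ) → Fin (d + 1) → ℝ) (e : ℝ), 0 < e →
        e ≤ eNC F hℓ₁ hLip d ℓ hℓ amin aplus m2plus ha creg β hcreg hβ S →
        (∀ x ∈ Box d ℓ k M, ∀ μ ν : Fin (d + 1),
          |Ac (x + e1 μ) ν - Ac x ν| ≤ creg * e ^ (β - 1) / ((ℓ + 1) ^ k : ℕ)) →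
      ∀ Φ : ↥(Box d ℓ k M) × ι → ℝ,
        supN (greenA d F (e / ((ℓ + 1) ^ k : ℕ)) ℓ k a m2 M (baseEmb hn M) (stairContour hn M)
            (fun u v => compField Ac u.1 v.1) *ᵥ Φ) ≤ cNC F hℓ₁ hLip d ℓ hℓ amin aplus m2plus ha * supN Φ ∧
        ∀ μ : Fin (d + 1),
          supN (derivA d F (e / ((ℓ + 1) ^ k : ℕ)) ℓ k M (fun u v => compField Ac u.1 v.1) μ
              *ᵥ (greenA d F (e / ((ℓ + 1) ^ k : ℕ)) ℓ k a m2 M (baseEmb hn M) (stairContour hn M)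
                  (fun u v => compField Ac u.1 v.1) *ᵥ Φ)) ≤ cNC F hℓ₁ hLip d ℓ hℓ amin aplus m2plus ha * supN Φ :=
  ((cNC_spec F hℓ₁ hLip d ℓ hℓ amin aplus m2plus ha).2 creg β hcreg hβ S).choose_spec

end Const

/-! ## §2 Frames with the regularity parameters and the enlarged `c_I` -/

variable (ι) in
/-- a `FrameR` together with the regularity parameters `c_reg ≥ 0`, `β > 0` of (2.23)/(1.7), the bound `S` on the box sides
(unit blocks), and the compatibility `a₊·C ≤ c_I` of the frame's `c_I` with the no-collar constant.
[cite: Balaban1982Higgs2, Lemma 2.4 p. 572; Balaban1983RegularityDecay, (1.7) p. 572] -/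
structure FrameS (d : ℕ) extends FrameR ι d where
  creg : ℝ
  β : ℝ
  hcreg : 0 ≤ creg
  hβ : 0 < β
  S : ℕ
  hcI : aplus * cNC F hℓ₁ hLip d ℓ hℓ amin aplus m2plus ha ≤ cI

namespace FrameS

variable {d : ℕ} (fr : FrameS ι d)

/-- the no-collar constant of the frame. [cite: Balaban1983RegularityDecay, Lemma 2.2 (2.17) p. 578] -/
abbrev kNC : ℝ := cNC fr.F fr.hℓ₁ fr.hLip d fr.ℓ fr.hℓ fr.amin fr.aplus fr.m2plus fr.ha
/-- the no-collar threshold of the frame. [cite: Balaban1983RegularityDecay, Theorem p. 573 «for e sufficiently small»] -/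
abbrev eNC1 : ℝ := eNC fr.F fr.hℓ₁ fr.hLip d fr.ℓ fr.hℓ fr.amin fr.aplus fr.m2plus fr.ha fr.creg fr.β fr.hcreg fr.hβ fr.S

/-- EVERY `FrameR` upgrades to a `FrameS` (given the regularity parameters and `S`): enlarge `c_I` to
`max c_I (a₊·C)` and `K_D` accordingly — both fields are choices of constants. [cite: Balaban1982Higgs2, Lemma 2.4 p. 572] -/
def ofFrameR (fr₀ : FrameR ι d) (creg β : ℝ) (hcreg : 0 ≤ creg) (hβ : 0 < β) (S : ℕ) : FrameS ι d :=
  let cI' : ℝ := max fr₀.cI (fr₀.aplus * cNC fr₀.F fr₀.hℓ₁ fr₀.hLip d fr₀.ℓ fr₀.hℓ fr₀.amin fr₀.aplus fr₀.m2plus fr₀.ha)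
  let KD' : ℝ := max fr₀.KD (cBL fr₀.F fr₀.hℓ₁ fr₀.hLip d fr₀.ℓ fr₀.hd fr₀.hℓ fr₀.amin fr₀.aplus fr₀.m2plus fr₀.ha
    * fr₀.ℓ₁ * cI' * ((((d : ℝ) + 1) * (1 + fr₀.ℓ₁) * fr₀.Kθ + fr₀.Kθ') + fr₀.Kθ))
  { toFrameR :=
      { toFrame := { fr₀.toFrame with
          cI := cI'
          KD := KD'
          cI_nonneg := le_max_of_le_left fr₀.cI_nonneg
          KD_nonneg := le_max_of_le_left fr₀.KD_nonneg }
        hd := fr₀.hd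
        Kθ' := fr₀.Kθ'
        Kθ'_nonneg := fr₀.Kθ'_nonneg
        hKD := le_max_right _ _ }
    creg := creg
    β := β
    hcreg := hcreg
    hβ := hβ
    S := S
    hcI := le_max_right _ _ }

/-- the upgraded frame keeps the flow. [cite: Balaban1982Higgs2, Lemma 2.4 p. 572] -/
@[simp] theorem ofFrameR_F (fr₀ : FrameR ι d) (creg β : ℝ) (hcreg : 0 ≤ creg) (hβ : 0 < β) (S : ℕ) :
    (ofFrameR fr₀ creg β hcreg hβ S).F = fr₀.F := rfl

/-- the upgraded frame keeps the block size. [cite: Balaban1982Higgs2, Lemma 2.4 p. 572] -/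
@[simp] theorem ofFrameR_ℓ (fr₀ : FrameR ι d) (creg β : ℝ) (hcreg : 0 ≤ creg) (hβ : 0 < β) (S : ℕ) :
    (ofFrameR fr₀ creg β hcreg hβ S).ℓ = fr₀.ℓ := rfl

/-- `c_I` can only grow. [cite: Balaban1982Higgs2, Lemma 2.4 p. 572] -/
theorem ofFrameR_cI_ge (fr₀ : FrameR ι d) (creg β : ℝ) (hcreg : 0 ≤ creg) (hβ : 0 < β) (S : ℕ) :
    fr₀.cI ≤ (ofFrameR fr₀ creg β hcreg hβ S).cI := le_max_left _ _

end FrameS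

/-! ## §3 The box lineage's own contour system, charge and field -/

section Data

variable {d : ℕ}

/-- the charge `κ = e·η = e/L^k` of the lineage's (1.6). [cite: Balaban1983RegularityDecay, (1.6) p. 572] -/
def κS (ℓ k : ℕ) (e : ℝ) : ℝ := e / ((ℓ + 1) ^ k : ℕ)

variable (d) in
/-- the corner embedding `y ↦ L^k·y` of the unit sites into the fine box. [cite: Balaban1983RegularityDecay, (1.4) p. 572] -/
def embS (ℓ k : ℕ) (M : Fin (d + 1) → ℕ) : ↥(boxDom M) → ↥(Box d ℓ k M) :=
  baseEmb (Nat.one_le_pow k (ℓ + 1) (Nat.succ_pos ℓ)) M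

variable (d) in
/-- the staircase contours `Γ^{(k)}_{y,x}` from the block corner to `x ∈ B^k(y)`. [cite: Balaban1983RegularityDecay, (1.4) p. 572] -/
def ΓS (ℓ k : ℕ) (M : Fin (d + 1) → ℕ) : ↥(boxDom M) → ↥(Box d ℓ k M) → List ↥(Box d ℓ k M) :=
  stairContour (Nat.one_le_pow k (ℓ + 1) (Nat.succ_pos ℓ)) M

variable (d) in
/-- `A' := compField Ac − constBond A₀` — the non-constant part of the component field `A^{(k)}|_□ = Ac` around
`A₀ = A^{(k)}(y)`. [cite: Balaban1982Higgs2, p. 572 «A^{(k)} − A₀ = O(p(L^kε)r(L^kε))»] -/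
def AprS (ℓ k : ℕ) (M : Fin (d + 1) → ℕ) (A₀ : Fin (d + 1) → ℝ) (Ac : (Fin (d + 1) → ℤ) → Fin (d + 1) → ℝ) :
    ↥(Box d ℓ k M) → ↥(Box d ℓ k M) → ℝ :=
  fun u v => compField Ac u.1 v.1 - constBond A₀ Subtype.val u v

/-- `A₀ + A' = compField Ac`. [cite: Balaban1982Higgs2, p. 572 «A₀ a constant configuration equal to A^{(k)}(y)»] -/
theorem constBond_add_AprS (ℓ k : ℕ) (M : Fin (d + 1) → ℕ) (A₀ : Fin (d + 1) → ℝ)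
    (Ac : (Fin (d + 1) → ℤ) → Fin (d + 1) → ℝ) :
    constBond A₀ Subtype.val + AprS d ℓ k M A₀ Ac = fun u v => compField Ac u.1 v.1 := by
  funext u v
  simp [AprS]

/-- the staircase contours end at the averaged point. [cite: Balaban1983RegularityDecay, (1.4) p. 572] -/
theorem hendS (ℓ k : ℕ) (M : Fin (d + 1) → ℕ) (y : ↥(boxDom M)) (x : ↥(Box d ℓ k M))
    (h : blkWt ((ℓ + 1) ^ k) M (fun i => (ℓ + 1) ^ k * M i) y x ≠ 0) : pathEnd (embS d ℓ k M y) (ΓS d ℓ k M y x) = x :=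
  stairContour_end (Nat.one_le_pow k (ℓ + 1) (Nat.succ_pos ℓ)) M y x h

end Data

/-! ## §4 The model with the box lineage's own data and a regular component field; `sup_g`, `sup_Dg` PROVED -/

/-- **ONE INSTANCE OF LEMMA 2.4 WITH THE SUP INPUTS DISCHARGEABLE**: the fields of `B2Lemma24RemD.ModelR` except
`κ, emb, Γ, hend, A', sup_g, sup_Dg`, with the charge `e` (`κ = e/L^k`, `0 < e ≤ e₁`), the box-size hypotheses `M_μ ≤ S`,
`3 ≤ L^kM_μ`, and the COMPONENT FIELD `Ac = A^{(k)}|_□`, (2.23)/(1.7)-regular on `□`: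
`|Ac(x + e_μ)_ν − Ac(x)_ν| ≤ c_reg·e^{β−1}/L^k` — every other hypothesis field stated for the substituted data
(`A' = compField Ac − constBond A₀`, corner embedding, staircase contours). [cite: Balaban1982Higgs2, (2.55) p. 570,
Lemma 2.3 (2.60) p. 571, Lemma 2.4 and its proof pp. 572–574; Balaban1983RegularityDecay, (1.7) p. 572] -/
structure ModelS {d : ℕ} (fr : FrameS ι d) (Yo : Type) [Fintype Yo] [DecidableEq Yo] where
  k : ℕ
  hk : 1 ≤ k
  a : ℝ
  m2 : ℝ
  ha1 : fr.amin ≤ a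
  ha2 : a ≤ fr.aplus
  hm1 : 0 ≤ m2
  hm2 : m2 ≤ fr.m2plus
  M : Fin (d + 1) → ℕ
  hM : ∀ i, 1 ≤ M i
  /-- box sides of at most `S` unit blocks. -/
  hMS : ∀ i, M i ≤ fr.S
  /-- fine sides `≥ 3`. -/
  hM3 : ∀ i, 3 ≤ (fr.ℓ + 1) ^ k * M i
  /-- the running charge `e = e(L^kε)` («for e(L^kε) sufficiently small»). -/
  e : ℝ
  he : 0 < e
  hle : e ≤ fr.eNC1
  A₀ : Fin (d + 1) → ℝ
  /-- the component field `A^{(k)}|_□`. -/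
  Ac : (Fin (d + 1) → ℤ) → Fin (d + 1) → ℝ
  /-- (2.23)/(1.7) on `□`: `|Ac(x + e_μ)_ν − Ac(x)_ν| ≤ c_reg e^{β−1}/L^k`. -/
  hreg : ∀ x ∈ Box d fr.ℓ k M, ∀ μ ν : Fin (d + 1),
    |Ac (x + e1 μ) ν - Ac x ν| ≤ fr.creg * e ^ (fr.β - 1) / ((fr.ℓ + 1) ^ k : ℕ)
  θ : ℝ
  τ : ℝ
  hθ : 0 ≤ θ
  hθ1 : θ ≤ 1
  hA' : ∀ x y : ↥(Box d fr.ℓ k M), y.1 ∈ nbrs x.1 → |κS fr.ℓ k e * AprS d fr.ℓ k M A₀ Ac x y| ≤ θ / ((fr.ℓ + 1) ^ k : ℕ)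
  hτ : 0 ≤ τ
  hτ1 : τ ≤ 1
  hτA : ∀ y x, blkWt ((fr.ℓ + 1) ^ k) M (fun i => (fr.ℓ + 1) ^ k * M i) y x ≠ 0 →
    |κS fr.ℓ k e * lsum (AprS d fr.ℓ k M A₀ Ac) (embS d fr.ℓ k M y) (ΓS d fr.ℓ k M y x)| ≤ τ
  hunit : IsUnit (opA d fr.F (κS fr.ℓ k e) fr.ℓ k a m2 M (embS d fr.ℓ k M) (ΓS d fr.ℓ k M)
    (constBond A₀ Subtype.val + AprS d fr.ℓ k M A₀ Ac)).det
  y : ↥(boxDom M)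
  sq1 : Finset ↥(boxDom M)
  y_mem : y ∈ sq1
  φ : ↥(boxDom M) → ι → ℝ
  p : ℝ
  q : ℝ
  tφ : ℝ
  R₁ : ℝ
  R₂ : ℝ
  R₄ : ℝ
  p_nonneg : 0 ≤ p
  q_nonneg : 0 ≤ q
  tφ_nonneg : 0 ≤ tφ
  R₂_nonneg : 0 ≤ R₂
  q_le : q ≤ fr.K₃ * p
  kap : m2 / (B1.aSeq a ((fr.ℓ : ℝ) + 1) k + m2) * tφ ≤ fr.K₁
  sepG : Real.exp (-(fr.dG * R₁)) * tφ ≤ fr.K₂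
  sepD : Real.exp (-(fr.dD * R₁)) * tφ ≤ fr.K₂
  sepO₂ : Real.exp (-(fr.δO / 2 * R₂)) * tφ ≤ fr.K₄
  sepO₄ : Real.exp (-(fr.δO * R₄)) * tφ ≤ fr.K₅
  θ_scale : θ * tφ ≤ fr.Kθ
  τ_scale : τ * tφ ≤ fr.Kτ
  far1 : ∀ x : ↥(Box d fr.ℓ k M), blkSite d fr.ℓ k M x = y → ∀ x' : ↥(Box d fr.ℓ k M), blkSite d fr.ℓ k M x' ∉ sq1 →
    R₁ ≤ supNorm (x.1 - x'.1) / (((fr.ℓ + 1) ^ k : ℕ) : ℝ)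
  Tout : Finset Yo
  inc : ↥(boxDom M) → Yo
  inc_inj : Function.Injective inc
  inc_mem : ∀ y' ∈ sq1, inc y' ∈ Tout
  KΩ : ↥(Box d fr.ℓ k M) → Yo → Matrix ι ι ℝ
  φΩ : Yo → ι → ℝ
  φΩ_inc : ∀ y' ∈ sq1, φΩ (inc y') = φ y'
  dΩ : ↥(Box d fr.ℓ k M) → Yo → ℝ
  dΩ_nonneg : ∀ x y', 0 ≤ dΩ x y'
  summableΩ : ∀ x, ∑ y' ∈ Tout, Real.exp (-(fr.δO / 2 * dΩ x y')) ≤ fr.SO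
  kerΩ_far : ∀ x, blkSite d fr.ℓ k M x = y → ∀ y' ∈ Tout, y' ∉ sq1.image inc → ∀ v,
    siteNorm (KΩ x y' *ᵥ v) ≤ fr.cO * Real.exp (-(fr.δO * dΩ x y')) * siteNorm v
  farΩ : ∀ x, blkSite d fr.ℓ k M x = y → ∀ y' ∈ Tout, y' ∉ sq1.image inc → R₂ ≤ dΩ x y'
  kerΩ_near : ∀ x, blkSite d fr.ℓ k M x = y → ∀ y' ∈ sq1, ∀ v,
    siteNorm ((KΩ x (inc y') - kerBox d fr.F (κS fr.ℓ k e) fr.ℓ k a m2 M (embS d fr.ℓ k M) (ΓS d fr.ℓ k M) A₀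
      (AprS d fr.ℓ k M A₀ Ac) x y') *ᵥ v)
      ≤ fr.cO * Real.exp (-(fr.δO * R₄)) * Real.exp (-(fr.δO * dΩ x (inc y'))) * siteNorm v
  dkerΩ_far : ∀ (μ : Fin (d + 1)) (x : ↥(Box d fr.ℓ k M)), blkSite d fr.ℓ k M x = y →
    ∀ (h : x.1 + e1 μ ∈ Box d fr.ℓ k M), ∀ y' ∈ Tout, y' ∉ sq1.image inc → ∀ v,
    siteNorm (dKer d fr.F (κS fr.ℓ k e) fr.ℓ k M (constBond A₀ Subtype.val + AprS d fr.ℓ k M A₀ Ac) KΩ μ x h y' *ᵥ v)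
      ≤ fr.cO * Real.exp (-(fr.δO * dΩ x y')) * siteNorm v
  dkerΩ_near : ∀ (μ : Fin (d + 1)) (x : ↥(Box d fr.ℓ k M)), blkSite d fr.ℓ k M x = y →
    ∀ (h : x.1 + e1 μ ∈ Box d fr.ℓ k M), ∀ y' ∈ sq1, ∀ v,
    siteNorm ((dKer d fr.F (κS fr.ℓ k e) fr.ℓ k M (constBond A₀ Subtype.val + AprS d fr.ℓ k M A₀ Ac) KΩ μ x h (inc y')
        - dkerBox d fr.F (κS fr.ℓ k e) fr.ℓ k a m2 M (embS d fr.ℓ k M) (ΓS d fr.ℓ k M) A₀ (AprS d fr.ℓ k M A₀ Ac)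
            μ x y') *ᵥ v)
      ≤ fr.cO * Real.exp (-(fr.δO * R₄)) * Real.exp (-(fr.δO * dΩ x (inc y'))) * siteNorm v
  θ' : ℝ
  hθ' : 0 ≤ θ'
  hder : ∀ (x z w : ↥(Box d fr.ℓ k M)) (μ : Fin (d + 1)), z.1 = x.1 + e1 μ → w.1 = z.1 + e1 μ →
    |κS fr.ℓ k e * (AprS d fr.ℓ k M A₀ Ac w z - AprS d fr.ℓ k M A₀ Ac z x)| ≤ θ' / ((((fr.ℓ + 1) ^ k : ℕ) : ℝ)) ^ 2 ∧
    |κS fr.ℓ k e * (AprS d fr.ℓ k M A₀ Ac x z - AprS d fr.ℓ k M A₀ Ac z w)| ≤ θ' / ((((fr.ℓ + 1) ^ k : ℕ) : ℝ)) ^ 2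
  θ'_scale : θ' * tφ ≤ fr.Kθ'
  R : ℕ
  hR1 : 1 ≤ R
  deep : ∀ x : ↥(Box d fr.ℓ k M), blkSite d fr.ℓ k M x = y →
    ∀ i, ((R * (fr.ℓ + 1) ^ k : ℕ) : ℤ) ≤ x.1 i ∧ x.1 i + (R * (fr.ℓ + 1) ^ k : ℕ) + 1 ≤ (((fr.ℓ + 1) ^ k * M i : ℕ) : ℤ)

namespace ModelS

variable {d : ℕ} {fr : FrameS ι d} {Yo : Type} [Fintype Yo] [DecidableEq Yo] (m : ModelS fr Yo)

/-- `□₁φ`. [cite: Balaban1982Higgs2, (2.67) p. 572] -/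
abbrev Ψ : ↥(boxDom m.M) × ι → ℝ := boxOneField m.sq1 m.φ

/-- the instance's `A'`. [cite: Balaban1982Higgs2, p. 572] -/
abbrev A' : ↥(Box d fr.ℓ m.k m.M) → ↥(Box d fr.ℓ m.k m.M) → ℝ := AprS d fr.ℓ m.k m.M m.A₀ m.Ac

/-- the instance's charge `κ = e/L^k`. [cite: Balaban1983RegularityDecay, (1.6) p. 572] -/
abbrev κ : ℝ := κS fr.ℓ m.k m.e

/-- **[B4] (2.17)_∞ FOR THE INSTANCE'S `G_k(□, A^{(k)})`, NO COLLAR**: `‖G_k(□,A)Φ‖_∞ ≤ C‖Φ‖_∞` and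
`‖D^η_{A,μ}G_k(□,A)Φ‖_∞ ≤ C‖Φ‖_∞` for every `Φ`, from r04's `lemma22_sup_noCollar` at the instance's data.
[cite: Balaban1983RegularityDecay, Lemma 2.2 (2.17) pp. 577–578, p. 579] -/
theorem sup_pair (Φ : ↥(Box d fr.ℓ m.k m.M) × ι → ℝ) :
    supN (greenA d fr.F m.κ fr.ℓ m.k m.a m.m2 m.M (embS d fr.ℓ m.k m.M) (ΓS d fr.ℓ m.k m.M)
        (constBond m.A₀ Subtype.val + m.A') *ᵥ Φ) ≤ fr.kNC * supN Φ ∧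
    ∀ μ : Fin (d + 1),
      supN (derivA d fr.F m.κ fr.ℓ m.k m.M (constBond m.A₀ Subtype.val + m.A') μ
          *ᵥ (greenA d fr.F m.κ fr.ℓ m.k m.a m.m2 m.M (embS d fr.ℓ m.k m.M) (ΓS d fr.ℓ m.k m.M)
              (constBond m.A₀ Subtype.val + m.A') *ᵥ Φ)) ≤ fr.kNC * supN Φ := by
  have h := (eNC_spec fr.F fr.hℓ₁ fr.hLip d fr.ℓ fr.hℓ fr.amin fr.aplus fr.m2plus fr.ha fr.creg fr.β fr.hcreg fr.hβ
    fr.S).2 m.k m.hk (Nat.one_le_pow m.k (fr.ℓ + 1) (Nat.succ_pos fr.ℓ)) m.a m.m2 m.ha1 m.ha2 m.hm1 m.hm2 m.M m.hM m.hMS m.hM3 m.Ac m.e m.he m.hle m.hreg Φ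
  rw [show constBond m.A₀ Subtype.val + m.A' = fun u v => compField m.Ac u.1 v.1 from
    constBond_add_AprS fr.ℓ m.k m.M m.A₀ m.Ac]
  exact h

/-- **THE INPUT `sup_g` IS A THEOREM**: `‖a_kG_k(□,A^{(k)})Q_k^*(A^{(k)})□₁φ‖_∞ ≤ c_I‖□₁φ‖_∞` — by (2.17)_∞ no-collar,
`‖Q_k^*(A)Ψ‖_∞ ≤ ‖Ψ‖_∞` (orthogonal transporters) and `a_k ≤ a₊`, `a₊C ≤ c_I`.
[cite: Balaban1982Higgs2, (2.68) p. 572 «Using … Proposition I.2.2»; Balaban1983RegularityDecay, (2.17) p. 578] -/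
theorem sup_g :
    supN (gVec d fr.F m.κ fr.ℓ m.k m.a m.m2 m.M (embS d fr.ℓ m.k m.M) (ΓS d fr.ℓ m.k m.M) m.A₀ m.A' m.Ψ)
      ≤ fr.cI * supN m.Ψ := by
  have hC0 : 0 < fr.kNC := (cNC_spec fr.F fr.hℓ₁ fr.hLip d fr.ℓ fr.hℓ fr.amin fr.aplus fr.m2plus fr.ha).1
  -- `0 < a_k ≤ a₊` ((I.2.15); as `B2Lemma24Proof.Model.hak`/`hakle`, which need a built `Model`)
  have hL : (1 : ℝ) < (fr.ℓ : ℝ) + 1 := by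
    have : (1 : ℝ) ≤ (fr.ℓ : ℝ) := by exact_mod_cast fr.hℓ
    linarith
  have hak : 0 < B1.aSeq m.a ((fr.ℓ : ℝ) + 1) m.k := B1.aSeq_pos (lt_of_lt_of_le fr.ha m.ha1) hL m.hk
  have hakle : B1.aSeq m.a ((fr.ℓ : ℝ) + 1) m.k ≤ fr.aplus :=
    (B1.aSeq_le (lt_of_lt_of_le fr.ha m.ha1) hL m.k m.hk).trans m.ha2
  set Φ := (avgA d fr.F m.κ fr.ℓ m.k m.M (embS d fr.ℓ m.k m.M) (ΓS d fr.ℓ m.k m.M)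
    (constBond m.A₀ Subtype.val + m.A'))ᵀ *ᵥ m.Ψ with hΦ
  have hΦle : supN Φ ≤ supN m.Ψ :=
    supN_le (supN_nonneg _) fun x' =>
      avgT_site fr.F m.κ m.M (embS d fr.ℓ m.k m.M) (ΓS d fr.ℓ m.k m.M) (constBond m.A₀ Subtype.val + m.A') m.Ψ x'
  have hG := (m.sup_pair Φ).1
  have hΨ0 : 0 ≤ supN m.Ψ := supN_nonneg _
  calc supN (gVec d fr.F m.κ fr.ℓ m.k m.a m.m2 m.M (embS d fr.ℓ m.k m.M) (ΓS d fr.ℓ m.k m.M) m.A₀ m.A' m.Ψ)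
      ≤ |B1.aSeq m.a ((fr.ℓ : ℝ) + 1) m.k| *
          supN (greenA d fr.F m.κ fr.ℓ m.k m.a m.m2 m.M (embS d fr.ℓ m.k m.M) (ΓS d fr.ℓ m.k m.M)
            (constBond m.A₀ Subtype.val + m.A') *ᵥ Φ) := supN_smul_le _ _
    _ ≤ fr.aplus * (fr.kNC * supN m.Ψ) := by
        rw [abs_of_pos hak]
        exact mul_le_mul hakle (hG.trans (mul_le_mul_of_nonneg_left hΦle hC0.le)) (supN_nonneg _)
          fr.aplus_pos.le
    _ = (fr.aplus * fr.kNC) * supN m.Ψ := by ring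
    _ ≤ fr.cI * supN m.Ψ := mul_le_mul_of_nonneg_right fr.hcI hΨ0

/-- **THE INPUT `sup_Dg` IS A THEOREM**: `‖D^η_{A^{(k)},μ}(a_kG_k(□,A^{(k)})Q_k^*(A^{(k)})□₁φ)‖_∞ ≤ c_I‖□₁φ‖_∞` for every `μ`.
[cite: Balaban1982Higgs2, (2.68) p. 572 «and similarly for the derivative»; Balaban1983RegularityDecay, (2.17) p. 578] -/
theorem sup_Dg (μ : Fin (d + 1)) :
    supN (derivA d fr.F m.κ fr.ℓ m.k m.M (constBond m.A₀ Subtype.val + m.A') μ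
        *ᵥ gVec d fr.F m.κ fr.ℓ m.k m.a m.m2 m.M (embS d fr.ℓ m.k m.M) (ΓS d fr.ℓ m.k m.M) m.A₀ m.A' m.Ψ)
      ≤ fr.cI * supN m.Ψ := by
  have hC0 : 0 < fr.kNC := (cNC_spec fr.F fr.hℓ₁ fr.hLip d fr.ℓ fr.hℓ fr.amin fr.aplus fr.m2plus fr.ha).1
  -- `0 < a_k ≤ a₊` ((I.2.15); as `B2Lemma24Proof.Model.hak`/`hakle`, which need a built `Model`)
  have hL : (1 : ℝ) < (fr.ℓ : ℝ) + 1 := by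
    have : (1 : ℝ) ≤ (fr.ℓ : ℝ) := by exact_mod_cast fr.hℓ
    linarith
  have hak : 0 < B1.aSeq m.a ((fr.ℓ : ℝ) + 1) m.k := B1.aSeq_pos (lt_of_lt_of_le fr.ha m.ha1) hL m.hk
  have hakle : B1.aSeq m.a ((fr.ℓ : ℝ) + 1) m.k ≤ fr.aplus :=
    (B1.aSeq_le (lt_of_lt_of_le fr.ha m.ha1) hL m.k m.hk).trans m.ha2
  set Φ := (avgA d fr.F m.κ fr.ℓ m.k m.M (embS d fr.ℓ m.k m.M) (ΓS d fr.ℓ m.k m.M)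
    (constBond m.A₀ Subtype.val + m.A'))ᵀ *ᵥ m.Ψ with hΦ
  have hΦle : supN Φ ≤ supN m.Ψ :=
    supN_le (supN_nonneg _) fun x' =>
      avgT_site fr.F m.κ m.M (embS d fr.ℓ m.k m.M) (ΓS d fr.ℓ m.k m.M) (constBond m.A₀ Subtype.val + m.A') m.Ψ x'
  have hD := (m.sup_pair Φ).2 μ
  have hΨ0 : 0 ≤ supN m.Ψ := supN_nonneg _
  have hsm : derivA d fr.F m.κ fr.ℓ m.k m.M (constBond m.A₀ Subtype.val + m.A') μ
        *ᵥ gVec d fr.F m.κ fr.ℓ m.k m.a m.m2 m.M (embS d fr.ℓ m.k m.M) (ΓS d fr.ℓ m.k m.M) m.A₀ m.A' m.Ψ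
      = B1.aSeq m.a ((fr.ℓ : ℝ) + 1) m.k •
          (derivA d fr.F m.κ fr.ℓ m.k m.M (constBond m.A₀ Subtype.val + m.A') μ
            *ᵥ (greenA d fr.F m.κ fr.ℓ m.k m.a m.m2 m.M (embS d fr.ℓ m.k m.M) (ΓS d fr.ℓ m.k m.M)
                (constBond m.A₀ Subtype.val + m.A') *ᵥ Φ)) := by
    rw [hΦ]; exact Matrix.mulVec_smul _ _ _
  rw [hsm]
  calc supN (B1.aSeq m.a ((fr.ℓ : ℝ) + 1) m.k •
          (derivA d fr.F m.κ fr.ℓ m.k m.M (constBond m.A₀ Subtype.val + m.A') μ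
            *ᵥ (greenA d fr.F m.κ fr.ℓ m.k m.a m.m2 m.M (embS d fr.ℓ m.k m.M) (ΓS d fr.ℓ m.k m.M)
                (constBond m.A₀ Subtype.val + m.A') *ᵥ Φ)))
      ≤ |B1.aSeq m.a ((fr.ℓ : ℝ) + 1) m.k| *
          supN (derivA d fr.F m.κ fr.ℓ m.k m.M (constBond m.A₀ Subtype.val + m.A') μ
            *ᵥ (greenA d fr.F m.κ fr.ℓ m.k m.a m.m2 m.M (embS d fr.ℓ m.k m.M) (ΓS d fr.ℓ m.k m.M)
                (constBond m.A₀ Subtype.val + m.A') *ᵥ Φ)) := supN_smul_le _ _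
    _ ≤ fr.aplus * (fr.kNC * supN m.Ψ) := by
        rw [abs_of_pos hak]
        exact mul_le_mul hakle (hD.trans (mul_le_mul_of_nonneg_left hΦle hC0.le)) (supN_nonneg _)
          fr.aplus_pos.le
    _ = (fr.aplus * fr.kNC) * supN m.Ψ := by ring
    _ ≤ fr.cI * supN m.Ψ := mul_le_mul_of_nonneg_right fr.hcI hΨ0

/-- **THE `ModelR` INSTANCE** built from the box lineage's own data, with `sup_g`, `sup_Dg` := the theorems and
`hend := stairContour_end`. [cite: Balaban1982Higgs2, Lemma 2.4 p. 572] -/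
def toModelR : ModelR fr.toFrameR Yo where
  k := m.k
  hk := m.hk
  a := m.a
  m2 := m.m2
  ha1 := m.ha1
  ha2 := m.ha2
  hm1 := m.hm1
  hm2 := m.hm2
  M := m.M
  hM := m.hM
  κ := m.κ
  emb := embS d fr.ℓ m.k m.M
  Γ := ΓS d fr.ℓ m.k m.M
  hend := fun y x h => hendS fr.ℓ m.k m.M y x h
  A₀ := m.A₀
  A' := m.A'
  θ := m.θ
  τ := m.τ
  hθ := m.hθ
  hθ1 := m.hθ1
  hA' := m.hA'
  hτ := m.hτ
  hτ1 := m.hτ1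
  hτA := m.hτA
  hunit := m.hunit
  y := m.y
  sq1 := m.sq1
  y_mem := m.y_mem
  φ := m.φ
  p := m.p
  q := m.q
  tφ := m.tφ
  R₁ := m.R₁
  R₂ := m.R₂
  R₄ := m.R₄
  p_nonneg := m.p_nonneg
  q_nonneg := m.q_nonneg
  tφ_nonneg := m.tφ_nonneg
  R₂_nonneg := m.R₂_nonneg
  q_le := m.q_le
  kap := m.kap
  sepG := m.sepG
  sepD := m.sepD
  sepO₂ := m.sepO₂
  sepO₄ := m.sepO₄
  θ_scale := m.θ_scale
  τ_scale := m.τ_scale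
  far1 := m.far1
  Tout := m.Tout
  inc := m.inc
  inc_inj := m.inc_inj
  inc_mem := m.inc_mem
  KΩ := m.KΩ
  φΩ := m.φΩ
  φΩ_inc := m.φΩ_inc
  dΩ := m.dΩ
  dΩ_nonneg := m.dΩ_nonneg
  summableΩ := m.summableΩ
  kerΩ_far := m.kerΩ_far
  farΩ := m.farΩ
  kerΩ_near := m.kerΩ_near
  dkerΩ_far := m.dkerΩ_far
  dkerΩ_near := m.dkerΩ_near
  sup_g := m.sup_g
  sup_Dg := m.sup_Dg
  θ' := m.θ'
  hθ' := m.hθ'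
  hder := m.hder
  θ'_scale := m.θ'_scale
  R := m.R
  hR1 := m.hR1
  deep := m.deep

/-- the built `ModelR` has the instance's scale `p`. [cite: Balaban1982Higgs2, Lemma 2.4 p. 572] -/
@[simp] theorem toModelR_p : m.toModelR.p = m.p := rfl

end ModelS

/-! ## §5 Row B2.Lem2.4 for the family with `sup_g`, `sup_Dg` (and `remD`) discharged -/

/-- the row's carrier filled by an instance: the `ModelR` carrier of the built instance (restrictions (2.55), the three
suprema of (2.65)/(2.66), the scale `p(L^kε)`). [cite: Balaban1982Higgs2, Lemma 2.4 p. 572] -/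
def famOfS {d : ℕ} (fr : FrameS ι d) (Yo : Type) [Fintype Yo] [DecidableEq Yo] (m : ModelS fr Yo) : B2.L24Setting :=
  famOfR fr.toFrameR Yo m.toModelR

/-- **ROW B2.Lem2.4 — LEMMA 2.4 (2.65)–(2.66), THE DECL OF RECORD `B2.Lemma24Printed`, PROVED FOR THE FAMILY OF INSTANCES
WHOSE [B4] (2.17)_∞ / «PROPOSITION I.2.2» INPUTS ARE THEOREMS** (box lineage's own contours and charge, (2.23)-regular
component field, no collar; `remD` already a theorem by `B2Lemma24RemD`): one constant `C` per frame and `dev265a, dev265b,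
dev266 ≤ C·p(L^kε)` for every instance obeying (2.55) — r04's `lemma24Printed_modelR` along `toModelR`.
[cite: Balaban1982Higgs2, Lemma 2.4 (2.65)–(2.66) p. 572; proof (2.67)–(2.77) pp. 572–574]
[cite: Balaban1983RegularityDecay, Lemma 2.2 (2.17) pp. 577–578] -/
theorem lemma24Printed_modelS {d : ℕ} (fr : FrameS ι d) (Yo : Type) [Fintype Yo] [DecidableEq Yo] :
    B2.Lemma24Printed (famOfS fr Yo) := by
  obtain ⟨C, h⟩ := lemma24Printed_modelR fr.toFrameR Yo
  exact ⟨C, fun m => h m.toModelR⟩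

/-! ## §6 (v1.1) Two more fields are free: `hunit` always holds, `hder` follows from `hreg` -/

section Free

variable {d : ℕ}

/-- **`hunit` IS FREE**: `H_k(□, A)` with the corner embedding and the staircase contours is invertible for EVERY bond
field `A` (`B4Lemma22Invertible.opA_stair_isUnit_det`, from the positivity (1.8) of the box form) — so the field `hunit`
of `ModelS` (kept for compatibility with `ModelR`) can always be filled by this term.
[cite: Balaban1983RegularityDecay, (1.6)/(1.8) pp. 572–573] -/
theorem hunit_holds (F : OrthFlow ι) {ℓ k : ℕ} (hℓ : 1 ≤ ℓ) (hk : 1 ≤ k) {a m2 : ℝ} (ha : 0 < a) (hm : 0 ≤ m2)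
    (M : Fin (d + 1) → ℕ) (e : ℝ) (A₀ : Fin (d + 1) → ℝ) (Ac : (Fin (d + 1) → ℤ) → Fin (d + 1) → ℝ) :
    IsUnit (opA d F (κS ℓ k e) ℓ k a m2 M (embS d ℓ k M) (ΓS d ℓ k M)
      (constBond A₀ Subtype.val + AprS d ℓ k M A₀ Ac)).det :=
  B4Lemma22Invertible.opA_stair_isUnit_det F (κS ℓ k e) hℓ hk (Nat.one_le_pow k (ℓ + 1) (Nat.succ_pos ℓ)) ha hm M _

/-- on a forward bond `A'(x, x + e_μ) = Ac(x)_μ − A₀_μ`. [cite: Balaban1982Higgs2, p. 572 «A^{(k)} − A₀»] -/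
theorem AprS_step {ℓ k : ℕ} {M : Fin (d + 1) → ℕ} (A₀ : Fin (d + 1) → ℝ)
    (Ac : (Fin (d + 1) → ℤ) → Fin (d + 1) → ℝ) {x z : ↥(Box d ℓ k M)} {μ : Fin (d + 1)} (h : z.1 = x.1 + e1 μ) :
    AprS d ℓ k M A₀ Ac x z = Ac x.1 μ - A₀ μ := by
  unfold AprS
  rw [B4Lower18RegularRegion.constBond_step A₀ h, h, B4Lower18RegularRegion.compField_add]

/-- on a backward bond `A'(x + e_μ, x) = −(Ac(x)_μ − A₀_μ)`. [cite: Balaban1982Higgs2, p. 572 «A^{(k)} − A₀»] -/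
theorem AprS_step_rev {ℓ k : ℕ} {M : Fin (d + 1) → ℕ} (A₀ : Fin (d + 1) → ℝ)
    (Ac : (Fin (d + 1) → ℤ) → Fin (d + 1) → ℝ) {x z : ↥(Box d ℓ k M)} {μ : Fin (d + 1)} (h : z.1 = x.1 + e1 μ) :
    AprS d ℓ k M A₀ Ac z x = -(Ac x.1 μ - A₀ μ) := by
  unfold AprS
  rw [B4Lower18RegularRegion.constBond_step_rev A₀ h, h, B4Lower18RegularRegion.compField_sub]
  ring

/-- **`hder` FOLLOWS FROM `hreg`** with `θ′ = c_reg·e^β`: on consecutive parallel bonds `(x, z = x + e_μ, w = z + e_μ)` of `□`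
the differences `A′(w,z) − A′(z,x)`, `A′(x,z) − A′(z,w)` are `∓(Ac(z)_μ − Ac(x)_μ)`, so (2.23)/(1.7)
`|Ac(x + e_μ)_μ − Ac(x)_μ| ≤ c_reg e^{β−1}/L^k` at charge `κ = e/L^k` gives `≤ c_reg e^β/L^{2k}` — the field `hder` of
`ModelS`/`ModelR` ((2.60) p. 571 in bond variables) is the along-direction part of the instance's own regularity hypothesis.
[cite: Balaban1982Higgs2, Lemma 2.3 (2.60) p. 571; Balaban1983RegularityDecay, (1.7) p. 572] -/
theorem hder_of_hreg {ℓ k : ℕ} {M : Fin (d + 1) → ℕ} (A₀ : Fin (d + 1) → ℝ)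
    (Ac : (Fin (d + 1) → ℤ) → Fin (d + 1) → ℝ) {creg β e : ℝ} (he : 0 < e)
    (hreg : ∀ x ∈ Box d ℓ k M, ∀ μ ν : Fin (d + 1),
      |Ac (x + e1 μ) ν - Ac x ν| ≤ creg * e ^ (β - 1) / ((ℓ + 1) ^ k : ℕ))
    (x z w : ↥(Box d ℓ k M)) (μ : Fin (d + 1)) (hz : z.1 = x.1 + e1 μ) (hw : w.1 = z.1 + e1 μ) :
    |κS ℓ k e * (AprS d ℓ k M A₀ Ac w z - AprS d ℓ k M A₀ Ac z x)|
        ≤ creg * e ^ β / ((((ℓ + 1) ^ k : ℕ) : ℝ)) ^ 2 ∧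
    |κS ℓ k e * (AprS d ℓ k M A₀ Ac x z - AprS d ℓ k M A₀ Ac z w)|
        ≤ creg * e ^ β / ((((ℓ + 1) ^ k : ℕ) : ℝ)) ^ 2 := by
  have hn : (0 : ℝ) < (((ℓ + 1) ^ k : ℕ) : ℝ) := by exact_mod_cast Nat.pos_of_ne_zero (by positivity)
  have hr := hreg x.1 x.2 μ μ
  rw [← hz] at hr
  have hκ : 0 ≤ κS ℓ k e := div_nonneg he.le hn.le
  -- the common value `|κ|·|Ac(z)_μ − Ac(x)_μ| ≤ c_reg e^β / n²`
  have key : |κS ℓ k e| * |Ac z.1 μ - Ac x.1 μ| ≤ creg * e ^ β / ((((ℓ + 1) ^ k : ℕ) : ℝ)) ^ 2 := by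
    rw [abs_of_nonneg hκ]
    have hpow : e * e ^ (β - 1) = e ^ β := by
      rw [Real.rpow_sub_one he.ne', mul_div_cancel₀ _ he.ne']
    calc κS ℓ k e * |Ac z.1 μ - Ac x.1 μ|
        ≤ κS ℓ k e * (creg * e ^ (β - 1) / ((ℓ + 1) ^ k : ℕ)) := mul_le_mul_of_nonneg_left hr hκ
      _ = creg * (e * e ^ (β - 1)) / ((((ℓ + 1) ^ k : ℕ) : ℝ)) ^ 2 := by
          unfold κS; field_simp
      _ = creg * e ^ β / ((((ℓ + 1) ^ k : ℕ) : ℝ)) ^ 2 := by rw [hpow]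
  have e1' : AprS d ℓ k M A₀ Ac w z - AprS d ℓ k M A₀ Ac z x = -(Ac z.1 μ - Ac x.1 μ) := by
    rw [AprS_step_rev A₀ Ac hw, AprS_step_rev A₀ Ac hz]; ring
  have e2' : AprS d ℓ k M A₀ Ac x z - AprS d ℓ k M A₀ Ac z w = -(Ac z.1 μ - Ac x.1 μ) := by
    rw [AprS_step A₀ Ac hz, AprS_step A₀ Ac hw]; ring
  refine ⟨?_, ?_⟩
  · rw [e1', abs_mul, abs_neg]; exact key
  · rw [e2', abs_mul, abs_neg]; exact key

/-- **`hτA` FOLLOWS FROM `hA'`** with `τ = (d+1)θ`: the staircase contour `Γ^{(k)}_{y,x}` has at most `(d+1)·L^k` bonds, each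
carrying `|κA′| ≤ θ/L^k` (`B4Lemma22SupStair.stair_lsum_le`). [cite: Balaban1983RegularityDecay, (1.4) p. 572; Balaban1982Higgs2, p. 572] -/
theorem hτA_of_hA' {ℓ k : ℕ} {M : Fin (d + 1) → ℕ} (A₀ : Fin (d + 1) → ℝ)
    (Ac : (Fin (d + 1) → ℤ) → Fin (d + 1) → ℝ) (e : ℝ) {θ : ℝ} (hθ : 0 ≤ θ)
    (hA' : ∀ x y : ↥(Box d ℓ k M), y.1 ∈ nbrs x.1 → |κS ℓ k e * AprS d ℓ k M A₀ Ac x y| ≤ θ / ((ℓ + 1) ^ k : ℕ))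
    (y : ↥(boxDom M)) (x : ↥(Box d ℓ k M)) :
    |κS ℓ k e * lsum (AprS d ℓ k M A₀ Ac) (embS d ℓ k M y) (ΓS d ℓ k M y x)| ≤ ((d : ℝ) + 1) * θ :=
  B4Lemma22SupStair.stair_lsum_le (κS ℓ k e) (Nat.one_le_pow k (ℓ + 1) (Nat.succ_pos ℓ)) M hθ hA' y x

/-- telescoping along the lineage's monotone staircase from `m` to `x ≥ m` inside a box: `|f(x) − f(m)| ≤ (d+1)·K·b` when each
unit step UP from a box point costs `≤ b` and `x_i − m_i ≤ K` (cf. the private `abs_sub_le_of_steps` of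
`B4Lemma22HolderNoCollar`, here without the membership demand on the step's endpoint). [folklore] -/
private theorem osc_le_of_steps {N : Fin (d + 1) → ℕ} {f : (Fin (d + 1) → ℤ) → ℝ} {b : ℝ} (hb : 0 ≤ b)
    (hstep : ∀ p ∈ boxDom N, ∀ μ, |f (p + e1 μ) - f p| ≤ b)
    {m x : Fin (d + 1) → ℤ} (hm : m ∈ boxDom N) (hx : x ∈ boxDom N) (hle : m ≤ x) {Kz : ℤ}
    (hK : ∀ i, x i - m i ≤ Kz) : |f x - f m| ≤ ((d : ℝ) + 1) * Kz * b := by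
  have hup : B4Lower18Regular.PathRel (fun u v : Fin (d + 1) → ℤ => ∃ μ, v = u + e1 μ) m (stair m x) :=
    pathRel_stairL_up x (List.finRange (d + 1)) m
  have hmem : ∀ z ∈ stair m x, z ∈ boxDom N := fun z hz =>
    mem_boxDom_of_between hm hx (mem_stair hle hz).1 (mem_stair hle hz).2
  have hpath := pathRel_chain (r := fun u v : Fin (d + 1) → ℤ => ∃ μ, v = u + e1 μ)
    (P := fun z => z ∈ boxDom N) _ _ hm (pathRel_and _ _ hup hmem)
  have hst : ∀ p q : Fin (d + 1) → ℤ,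
      (p ∈ boxDom N ∧ ((∃ μ, q = p + e1 μ) ∧ q ∈ boxDom N)) → |f q - f p| ≤ b := by
    rintro p q ⟨hp, ⟨μ, rfl⟩, -⟩
    exact hstep p hp μ
  have htel := abs_sub_le_of_pathRel (f := f) hst _ _ hpath
  rw [pathEnd_stair hle] at htel
  have hlen : ((stair m x).length : ℝ) ≤ ((d : ℝ) + 1) * Kz := by
    have h := length_stair_le hle (K := Kz) hK
    exact_mod_cast h
  exact htel.trans (mul_le_mul_of_nonneg_right hlen hb)

/-- the oscillation of a (2.23)/(1.7)-regular component over the fine box: `|Ac(u)_ν − Ac(x₀)_ν| ≤ 2(d+1)·S·c_reg·e^{β−1}`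
for `u, x₀ ∈ □`, box sides `M_i ≤ S` (two monotone staircases from the corner, `(d+1)·L^kS` steps each, each
`≤ c_reg e^{β−1}/L^k`). [cite: Balaban1982Higgs2, p. 572 «From the property (2.60) we have the inequality |A^{(k)}(x) − A^{(k)}(y)|
≤ O(p(Lᵏε)r(Lᵏε))»; Balaban1983RegularityDecay, (1.7) p. 572] -/
theorem osc_of_hreg {ℓ k : ℕ} {M : Fin (d + 1) → ℕ} {S : ℕ} (hM : ∀ i, 1 ≤ M i) (hMS : ∀ i, M i ≤ S)
    (Ac : (Fin (d + 1) → ℤ) → Fin (d + 1) → ℝ) {creg β e : ℝ} (hcreg : 0 ≤ creg) (he : 0 < e)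
    (hreg : ∀ x ∈ Box d ℓ k M, ∀ μ ν : Fin (d + 1),
      |Ac (x + e1 μ) ν - Ac x ν| ≤ creg * e ^ (β - 1) / ((ℓ + 1) ^ k : ℕ))
    (u x₀ : ↥(Box d ℓ k M)) (ν : Fin (d + 1)) :
    |Ac u.1 ν - Ac x₀.1 ν| ≤ 2 * ((d : ℝ) + 1) * S * (creg * e ^ (β - 1)) := by
  have hn1 : 1 ≤ (ℓ + 1) ^ k := Nat.one_le_pow k (ℓ + 1) (Nat.succ_pos ℓ)
  have hn : (0 : ℝ) < (((ℓ + 1) ^ k : ℕ) : ℝ) := by exact_mod_cast hn1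
  set b : ℝ := creg * e ^ (β - 1) / (((ℓ + 1) ^ k : ℕ) : ℝ) with hb_def
  have hb : 0 ≤ b := div_nonneg (mul_nonneg hcreg (Real.rpow_nonneg he.le _)) hn.le
  have hstep : ∀ p ∈ Box d ℓ k M, ∀ μ, |(fun z => Ac z ν) (p + e1 μ) - (fun z => Ac z ν) p| ≤ b :=
    fun p hp μ => hreg p hp μ ν
  have h0 : (0 : Fin (d + 1) → ℤ) ∈ Box d ℓ k M := by
    rw [mem_boxDom]; intro i
    have : 0 < (ℓ + 1) ^ k * M i := Nat.mul_pos (by omega) (hM i)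
    refine ⟨le_rfl, ?_⟩
    rw [Pi.zero_apply]
    exact_mod_cast this
  -- each coordinate of a box point is `< L^kM_i ≤ L^kS`
  have hK : ∀ (w : ↥(Box d ℓ k M)) (i : Fin (d + 1)),
      w.1 i - (0 : Fin (d + 1) → ℤ) i ≤ (((ℓ + 1) ^ k * S : ℕ) : ℤ) := by
    intro w i
    have h1 := (mem_boxDom.mp w.2 i).2
    have h2 : (((ℓ + 1) ^ k * M i : ℕ) : ℤ) ≤ (((ℓ + 1) ^ k * S : ℕ) : ℤ) := by
      exact_mod_cast Nat.mul_le_mul_left _ (hMS i)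
    rw [Pi.zero_apply, sub_zero]
    omega
  have hle : ∀ (w : ↥(Box d ℓ k M)), (0 : Fin (d + 1) → ℤ) ≤ w.1 := fun w i => (mem_boxDom.mp w.2 i).1
  have h1 := osc_le_of_steps (f := fun z => Ac z ν) hb hstep h0 u.2 (hle u) (hK u)
  have h2 := osc_le_of_steps (f := fun z => Ac z ν) hb hstep h0 x₀.2 (hle x₀) (hK x₀)
  have hKb : ((d : ℝ) + 1) * ((((ℓ + 1) ^ k * S : ℕ) : ℤ) : ℝ) * b = ((d : ℝ) + 1) * S * (creg * e ^ (β - 1)) := by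
    rw [hb_def]; push_cast; field_simp
  rw [hKb] at h1 h2
  calc |Ac u.1 ν - Ac x₀.1 ν| = |(Ac u.1 ν - Ac 0 ν) - (Ac x₀.1 ν - Ac 0 ν)| := by ring_nf
    _ ≤ |Ac u.1 ν - Ac 0 ν| + |Ac x₀.1 ν - Ac 0 ν| := abs_sub _ _
    _ ≤ ((d : ℝ) + 1) * S * (creg * e ^ (β - 1)) + ((d : ℝ) + 1) * S * (creg * e ^ (β - 1)) := add_le_add h1 h2
    _ = 2 * ((d : ℝ) + 1) * S * (creg * e ^ (β - 1)) := by ring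

/-- **`hA'` FOLLOWS FROM `hreg`** once `A₀ = A^{(k)}(x₀)` for a point `x₀ ∈ □` (print: `A₀ = A^{(k)}(y)`), with
`θ = 2(d+1)·S·c_reg·e^β`: on a nearest-neighbour bond `A′ = ±(Ac_μ − A₀_μ)`, so `|κA′| ≤ (e/L^k)·2(d+1)S c_reg e^{β−1}`.
[cite: Balaban1982Higgs2, p. 572 «Let us denote by A₀ a constant configuration equal to A^{(k)}(y) at each point, thus
A^{(k)} − A₀ = O(p(Lᵏε)r(Lᵏε))»; Balaban1983RegularityDecay, (1.7) p. 572] -/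
theorem hA'_of_hreg {ℓ k : ℕ} {M : Fin (d + 1) → ℕ} {S : ℕ} (hM : ∀ i, 1 ≤ M i) (hMS : ∀ i, M i ≤ S)
    (A₀ : Fin (d + 1) → ℝ) (Ac : (Fin (d + 1) → ℤ) → Fin (d + 1) → ℝ) {creg β e : ℝ} (hcreg : 0 ≤ creg) (he : 0 < e)
    (hreg : ∀ x ∈ Box d ℓ k M, ∀ μ ν : Fin (d + 1),
      |Ac (x + e1 μ) ν - Ac x ν| ≤ creg * e ^ (β - 1) / ((ℓ + 1) ^ k : ℕ))
    (x₀ : ↥(Box d ℓ k M)) (hA0 : ∀ μ, A₀ μ = Ac x₀.1 μ)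
    (x y : ↥(Box d ℓ k M)) (hxy : y.1 ∈ nbrs x.1) :
    |κS ℓ k e * AprS d ℓ k M A₀ Ac x y| ≤ (2 * ((d : ℝ) + 1) * S * creg * e ^ β) / ((ℓ + 1) ^ k : ℕ) := by
  have hn : (0 : ℝ) < (((ℓ + 1) ^ k : ℕ) : ℝ) := by exact_mod_cast Nat.one_le_pow k (ℓ + 1) (Nat.succ_pos ℓ)
  have hκ : 0 ≤ κS ℓ k e := div_nonneg he.le hn.le
  have hpow : e * e ^ (β - 1) = e ^ β := by
    rw [Real.rpow_sub_one he.ne', mul_div_cancel₀ _ he.ne']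
  -- the bond value is `±(Ac_μ(site) − A₀_μ)` for the lower endpoint `site` of the bond
  obtain ⟨i, hi | hi⟩ := mem_nbrs.mp hxy
  · have hstep : y.1 = x.1 + e1 i := hi
    rw [AprS_step A₀ Ac hstep, hA0 i, abs_mul, abs_of_nonneg hκ]
    calc κS ℓ k e * |Ac x.1 i - Ac x₀.1 i|
        ≤ κS ℓ k e * (2 * ((d : ℝ) + 1) * S * (creg * e ^ (β - 1))) :=
          mul_le_mul_of_nonneg_left (osc_of_hreg hM hMS Ac hcreg he hreg x x₀ i) hκ
      _ = (2 * ((d : ℝ) + 1) * S * creg * (e * e ^ (β - 1))) / ((ℓ + 1) ^ k : ℕ) := by unfold κS; ring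
      _ = (2 * ((d : ℝ) + 1) * S * creg * e ^ β) / ((ℓ + 1) ^ k : ℕ) := by rw [hpow]
  · have hstep : x.1 = y.1 + e1 i := by rw [hi]; simp [e1]
    rw [AprS_step_rev A₀ Ac hstep, hA0 i, abs_mul, abs_neg, abs_of_nonneg hκ]
    calc κS ℓ k e * |Ac y.1 i - Ac x₀.1 i|
        ≤ κS ℓ k e * (2 * ((d : ℝ) + 1) * S * (creg * e ^ (β - 1))) :=
          mul_le_mul_of_nonneg_left (osc_of_hreg hM hMS Ac hcreg he hreg y x₀ i) hκ
      _ = (2 * ((d : ℝ) + 1) * S * creg * (e * e ^ (β - 1))) / ((ℓ + 1) ^ k : ℕ) := by unfold κS; ring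
      _ = (2 * ((d : ℝ) + 1) * S * creg * e ^ β) / ((ℓ + 1) ^ k : ℕ) := by rw [hpow]

end Free

/-! ## §7 (v1.2) `ModelT`: the instance type WITHOUT the four free/derived fields -/

section ModelT

variable {d : ℕ}

variable (d) in
/-- `A₀ := A^{(k)}(x₀)`, the component field's value at the base point (print: `A₀ = A^{(k)}(y)`).
[cite: Balaban1982Higgs2, p. 572 «Let us denote by A₀ a constant configuration equal to A^{(k)}(y) at each point»] -/
def A0S {ℓ k : ℕ} {M : Fin (d + 1) → ℕ} (Ac : (Fin (d + 1) → ℤ) → Fin (d + 1) → ℝ) (x₀ : ↥(Box d ℓ k M)) :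
    Fin (d + 1) → ℝ :=
  fun μ => Ac x₀.1 μ

/-- the size parameter `θ = 2(d+1)·S·c_reg·e^β` of `A′ = A^{(k)} − A₀` derived from (2.23) (`hA'_of_hreg`).
[cite: Balaban1982Higgs2, p. 572 «A^{(k)} − A₀ = O(p(Lᵏε)r(Lᵏε))»] -/
def thetaS (d S : ℕ) (creg β e : ℝ) : ℝ := 2 * ((d : ℝ) + 1) * S * creg * e ^ β

/-- `θ ≥ 0`. [cite: Balaban1982Higgs2, p. 572] -/
theorem thetaS_nonneg (d S : ℕ) {creg β e : ℝ} (hcreg : 0 ≤ creg) (he : 0 < e) : 0 ≤ thetaS d S creg β e := by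
  unfold thetaS
  have : 0 ≤ e ^ β := Real.rpow_nonneg he.le _
  positivity

/-- **ONE INSTANCE OF LEMMA 2.4 WITH ONLY THE (2.58) SHAPES AS HYPOTHESIS FIELDS** (besides data, geometry, the
instance's (2.23) regularity, the smallness of `e(L^kε)` and the scale products): the fields of `ModelS` except
`A₀` (:= `A^{(k)}(x₀)` for a base point `x₀ ∈ □`), `hunit` (free), `θ, hθ, hθ1, hA'` (θ := `2(d+1)S c_reg e^β`, derived),
`τ, hτ, hτ1, hτA` (τ := `(d+1)θ`, derived), `θ', hθ', hder` (θ′ := `c_reg e^β`, derived); the demands `θ ≤ 1`, `τ ≤ 1` become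
the smallness hypotheses `hθ1`, `hτ1` on `e` («for e(L^kε) sufficiently small»), and the three scale products are stated for
the derived parameters. [cite: Balaban1982Higgs2, (2.55) p. 570, Lemma 2.3 (2.60) p. 571, Lemma 2.4 and its proof pp. 572–574;
Balaban1983RegularityDecay, (1.7) p. 572] -/
structure ModelT {d : ℕ} (fr : FrameS ι d) (Yo : Type) [Fintype Yo] [DecidableEq Yo] where
  k : ℕ
  hk : 1 ≤ k
  a : ℝ
  m2 : ℝ
  ha1 : fr.amin ≤ a
  ha2 : a ≤ fr.aplus
  hm1 : 0 ≤ m2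
  hm2 : m2 ≤ fr.m2plus
  M : Fin (d + 1) → ℕ
  hM : ∀ i, 1 ≤ M i
  hMS : ∀ i, M i ≤ fr.S
  hM3 : ∀ i, 3 ≤ (fr.ℓ + 1) ^ k * M i
  e : ℝ
  he : 0 < e
  hle : e ≤ fr.eNC1
  /-- `θ = 2(d+1)S c_reg e^β ≤ 1` -/
  hθ1 : thetaS d fr.S fr.creg fr.β e ≤ 1
  /-- `τ = (d+1)θ ≤ 1` -/
  hτ1 : ((d : ℝ) + 1) * thetaS d fr.S fr.creg fr.β e ≤ 1
  Ac : (Fin (d + 1) → ℤ) → Fin (d + 1) → ℝ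
  hreg : ∀ x ∈ Box d fr.ℓ k M, ∀ μ ν : Fin (d + 1),
    |Ac (x + e1 μ) ν - Ac x ν| ≤ fr.creg * e ^ (fr.β - 1) / ((fr.ℓ + 1) ^ k : ℕ)
  /-- the base point `x₀ ∈ □` of `A₀ = A^{(k)}(x₀)` (print: the block point `y`) -/
  x₀ : ↥(Box d fr.ℓ k M)
  y : ↥(boxDom M)
  sq1 : Finset ↥(boxDom M)
  y_mem : y ∈ sq1
  φ : ↥(boxDom M) → ι → ℝ
  p : ℝ
  q : ℝ
  tφ : ℝ
  R₁ : ℝ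
  R₂ : ℝ
  R₄ : ℝ
  p_nonneg : 0 ≤ p
  q_nonneg : 0 ≤ q
  tφ_nonneg : 0 ≤ tφ
  R₂_nonneg : 0 ≤ R₂
  q_le : q ≤ fr.K₃ * p
  kap : m2 / (B1.aSeq a ((fr.ℓ : ℝ) + 1) k + m2) * tφ ≤ fr.K₁
  sepG : Real.exp (-(fr.dG * R₁)) * tφ ≤ fr.K₂
  sepD : Real.exp (-(fr.dD * R₁)) * tφ ≤ fr.K₂
  sepO₂ : Real.exp (-(fr.δO / 2 * R₂)) * tφ ≤ fr.K₄
  sepO₄ : Real.exp (-(fr.δO * R₄)) * tφ ≤ fr.K₅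
  /-- `θt_φ ≤ K_θ` for the derived `θ` -/
  θ_scale : thetaS d fr.S fr.creg fr.β e * tφ ≤ fr.Kθ
  /-- `τt_φ ≤ K_τ` for the derived `τ = (d+1)θ` -/
  τ_scale : ((d : ℝ) + 1) * thetaS d fr.S fr.creg fr.β e * tφ ≤ fr.Kτ
  /-- `θ′t_φ ≤ K_{θ′}` for the derived `θ′ = c_reg e^β` -/
  θ'_scale : fr.creg * e ^ fr.β * tφ ≤ fr.Kθ'
  far1 : ∀ x : ↥(Box d fr.ℓ k M), blkSite d fr.ℓ k M x = y → ∀ x' : ↥(Box d fr.ℓ k M), blkSite d fr.ℓ k M x' ∉ sq1 →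
    R₁ ≤ supNorm (x.1 - x'.1) / (((fr.ℓ + 1) ^ k : ℕ) : ℝ)
  Tout : Finset Yo
  inc : ↥(boxDom M) → Yo
  inc_inj : Function.Injective inc
  inc_mem : ∀ y' ∈ sq1, inc y' ∈ Tout
  KΩ : ↥(Box d fr.ℓ k M) → Yo → Matrix ι ι ℝ
  φΩ : Yo → ι → ℝ
  φΩ_inc : ∀ y' ∈ sq1, φΩ (inc y') = φ y'
  dΩ : ↥(Box d fr.ℓ k M) → Yo → ℝ
  dΩ_nonneg : ∀ x y', 0 ≤ dΩ x y'
  summableΩ : ∀ x, ∑ y' ∈ Tout, Real.exp (-(fr.δO / 2 * dΩ x y')) ≤ fr.SO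
  kerΩ_far : ∀ x, blkSite d fr.ℓ k M x = y → ∀ y' ∈ Tout, y' ∉ sq1.image inc → ∀ v,
    siteNorm (KΩ x y' *ᵥ v) ≤ fr.cO * Real.exp (-(fr.δO * dΩ x y')) * siteNorm v
  farΩ : ∀ x, blkSite d fr.ℓ k M x = y → ∀ y' ∈ Tout, y' ∉ sq1.image inc → R₂ ≤ dΩ x y'
  kerΩ_near : ∀ x, blkSite d fr.ℓ k M x = y → ∀ y' ∈ sq1, ∀ v,
    siteNorm ((KΩ x (inc y') - kerBox d fr.F (κS fr.ℓ k e) fr.ℓ k a m2 M (embS d fr.ℓ k M) (ΓS d fr.ℓ k M) (A0S d Ac x₀)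
      (AprS d fr.ℓ k M (A0S d Ac x₀) Ac) x y') *ᵥ v)
      ≤ fr.cO * Real.exp (-(fr.δO * R₄)) * Real.exp (-(fr.δO * dΩ x (inc y'))) * siteNorm v
  dkerΩ_far : ∀ (μ : Fin (d + 1)) (x : ↥(Box d fr.ℓ k M)), blkSite d fr.ℓ k M x = y →
    ∀ (h : x.1 + e1 μ ∈ Box d fr.ℓ k M), ∀ y' ∈ Tout, y' ∉ sq1.image inc → ∀ v,
    siteNorm (dKer d fr.F (κS fr.ℓ k e) fr.ℓ k M (constBond (A0S d Ac x₀) Subtype.val + AprS d fr.ℓ k M (A0S d Ac x₀) Ac)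
        KΩ μ x h y' *ᵥ v)
      ≤ fr.cO * Real.exp (-(fr.δO * dΩ x y')) * siteNorm v
  dkerΩ_near : ∀ (μ : Fin (d + 1)) (x : ↥(Box d fr.ℓ k M)), blkSite d fr.ℓ k M x = y →
    ∀ (h : x.1 + e1 μ ∈ Box d fr.ℓ k M), ∀ y' ∈ sq1, ∀ v,
    siteNorm ((dKer d fr.F (κS fr.ℓ k e) fr.ℓ k M
        (constBond (A0S d Ac x₀) Subtype.val + AprS d fr.ℓ k M (A0S d Ac x₀) Ac) KΩ μ x h (inc y')
        - dkerBox d fr.F (κS fr.ℓ k e) fr.ℓ k a m2 M (embS d fr.ℓ k M) (ΓS d fr.ℓ k M) (A0S d Ac x₀)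
            (AprS d fr.ℓ k M (A0S d Ac x₀) Ac) μ x y') *ᵥ v)
      ≤ fr.cO * Real.exp (-(fr.δO * R₄)) * Real.exp (-(fr.δO * dΩ x (inc y'))) * siteNorm v
  R : ℕ
  hR1 : 1 ≤ R
  deep : ∀ x : ↥(Box d fr.ℓ k M), blkSite d fr.ℓ k M x = y →
    ∀ i, ((R * (fr.ℓ + 1) ^ k : ℕ) : ℤ) ≤ x.1 i ∧ x.1 i + (R * (fr.ℓ + 1) ^ k : ℕ) + 1 ≤ (((fr.ℓ + 1) ^ k * M i : ℕ) : ℤ)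

namespace ModelT

variable {fr : FrameS ι d} {Yo : Type} [Fintype Yo] [DecidableEq Yo] (m : ModelT fr Yo)

/-- the derived `θ`. [cite: Balaban1982Higgs2, p. 572] -/
abbrev θ : ℝ := thetaS d fr.S fr.creg fr.β m.e

/-- `θ ≥ 0`. [cite: Balaban1982Higgs2, p. 572] -/
theorem hθ : 0 ≤ m.θ := thetaS_nonneg d fr.S fr.hcreg m.he

/-- **THE `ModelS` INSTANCE**: `A₀ := A^{(k)}(x₀)`, `hunit := hunit_holds`, `hA' := hA'_of_hreg`, `hτA := hτA_of_hA'`,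
`hder := hder_of_hreg`, with `θ = 2(d+1)S c_reg e^β`, `τ = (d+1)θ`, `θ′ = c_reg e^β`. [cite: Balaban1982Higgs2, Lemma 2.4 p. 572] -/
def toModelS : ModelS fr Yo where
  k := m.k
  hk := m.hk
  a := m.a
  m2 := m.m2
  ha1 := m.ha1
  ha2 := m.ha2
  hm1 := m.hm1
  hm2 := m.hm2
  M := m.M
  hM := m.hM
  hMS := m.hMS
  hM3 := m.hM3
  e := m.e
  he := m.he
  hle := m.hle
  A₀ := A0S d m.Ac m.x₀
  Ac := m.Ac
  hreg := m.hreg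
  θ := m.θ
  τ := ((d : ℝ) + 1) * m.θ
  hθ := m.hθ
  hθ1 := m.hθ1
  hA' := fun x y hxy => by
    have h := hA'_of_hreg (β := fr.β) m.hM m.hMS (A0S d m.Ac m.x₀) m.Ac fr.hcreg m.he m.hreg m.x₀ (fun μ => rfl) x y hxy
    simpa only [thetaS] using h
  hτ := mul_nonneg (by positivity) m.hθ
  hτ1 := m.hτ1
  hτA := fun y x _ =>
    hτA_of_hA' (A0S d m.Ac m.x₀) m.Ac m.e m.hθ (fun x' y' hxy => by
      have h := hA'_of_hreg (β := fr.β) m.hM m.hMS (A0S d m.Ac m.x₀) m.Ac fr.hcreg m.he m.hreg m.x₀ (fun μ => rfl) x' y' hxy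
      simpa only [thetaS] using h) y x
  hunit := hunit_holds fr.F fr.hℓ m.hk (lt_of_lt_of_le fr.ha m.ha1) m.hm1 m.M m.e (A0S d m.Ac m.x₀) m.Ac
  y := m.y
  sq1 := m.sq1
  y_mem := m.y_mem
  φ := m.φ
  p := m.p
  q := m.q
  tφ := m.tφ
  R₁ := m.R₁
  R₂ := m.R₂
  R₄ := m.R₄
  p_nonneg := m.p_nonneg
  q_nonneg := m.q_nonneg
  tφ_nonneg := m.tφ_nonneg
  R₂_nonneg := m.R₂_nonneg
  q_le := m.q_le
  kap := m.kap
  sepG := m.sepG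
  sepD := m.sepD
  sepO₂ := m.sepO₂
  sepO₄ := m.sepO₄
  θ_scale := m.θ_scale
  τ_scale := m.τ_scale
  far1 := m.far1
  Tout := m.Tout
  inc := m.inc
  inc_inj := m.inc_inj
  inc_mem := m.inc_mem
  KΩ := m.KΩ
  φΩ := m.φΩ
  φΩ_inc := m.φΩ_inc
  dΩ := m.dΩ
  dΩ_nonneg := m.dΩ_nonneg
  summableΩ := m.summableΩ
  kerΩ_far := m.kerΩ_far
  farΩ := m.farΩ
  kerΩ_near := m.kerΩ_near
  dkerΩ_far := m.dkerΩ_far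
  dkerΩ_near := m.dkerΩ_near
  θ' := fr.creg * m.e ^ fr.β
  hθ' := mul_nonneg fr.hcreg (Real.rpow_nonneg m.he.le _)
  hder := fun x z w μ hz hw => hder_of_hreg (A0S d m.Ac m.x₀) m.Ac m.he m.hreg x z w μ hz hw
  θ'_scale := m.θ'_scale
  R := m.R
  hR1 := m.hR1
  deep := m.deep

/-- the built instance has the instance's scale `p`. [cite: Balaban1982Higgs2, Lemma 2.4 p. 572] -/
@[simp] theorem toModelS_p : m.toModelS.p = m.p := rfl

end ModelT

/-- the row's carrier filled by a `ModelT` instance. [cite: Balaban1982Higgs2, Lemma 2.4 p. 572] -/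
def famOfT {d : ℕ} (fr : FrameS ι d) (Yo : Type) [Fintype Yo] [DecidableEq Yo] (m : ModelT fr Yo) : B2.L24Setting :=
  famOfS fr Yo m.toModelS

/-- **ROW B2.Lem2.4 — `B2.Lemma24Printed` FOR THE FAMILY WHOSE ONLY HYPOTHESIS SHAPES ARE THE FOUR (2.58) KERNEL FIELDS**
(everything else: data, the instance's (2.23) regularity, smallness of `e(L^kε)`, geometry, scale products, and (2.55) via
`Restr`): one constant per frame, `dev265a, dev265b, dev266 ≤ C·p(L^kε)` for every instance — `lemma24Printed_modelS` along
`toModelS`. [cite: Balaban1982Higgs2, Lemma 2.4 (2.65)–(2.66) p. 572; proof (2.67)–(2.77) pp. 572–574]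
[cite: Balaban1983RegularityDecay, (1.7) p. 572, Lemma 2.2 (2.17) pp. 577–578] -/
theorem lemma24Printed_modelT {d : ℕ} (fr : FrameS ι d) (Yo : Type) [Fintype Yo] [DecidableEq Yo] :
    B2.Lemma24Printed (famOfT fr Yo) := by
  obtain ⟨C, h⟩ := lemma24Printed_modelS fr Yo
  exact ⟨C, fun m => h m.toModelS⟩

end ModelT

end

end Literature.MathematicalPhysics.QuantumFieldTheory.Balaban1983to89.B2Lemma24SupG
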